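import Summits.AnomalousDissipation.AnomalousDissipation.Theorems.MomentParityMomentClosure
import Summits.AnomalousDissipation.AnomalousDissipation.Theorems.QuarticGate.Negative.LevelCeiling

/-!
# Stub `stub_cylOfPoly` of the line `Sketch`
# (crux stmt-AnomalousDissipation-14330, `MomentParity.UniformResolution`)

**All-order polynomial rows give FMRT's cylindrical rows on the level ball.** A probability law `μ`
on `H = L²_σ(T³)` carried by the compact level ball `{u level-N, ‖u‖ ≤ R}` which annihilates the
tested Galerkin–Navier–Stokes generator `⟨F(u), ∇p(u)⟩` of EVERY polynomial cylindrical observable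
`p((u,g₁),…,(u,gₘ))` with level-`N` band fields `gᵢ` (polynomial stationarity `IsPolyStationary ν f N d μ`
at every order `d`) annihilates the generator row `⟨F(u), Φ'(u)⟩` of every compactly supported `C¹`
cylindrical test functional `Φ` with level-`N` band fields, and that row is integrable.

Proof: the row is continuous on `H` (`Torus.continuous_nsGeneratorPairing_grad`), hence integrable
on the compact carrier (`isCompact_levelBall`, `integrable_of_continuous_of_ae_mem`); the vanishing is
the tree's `C¹`-Weierstrass upgrade `MomentParityMomentClosure.integral_nsGeneratorPairing_grad_eq_zero`
fed with the polynomial rows of order `deg p + 1`.  The vocabulary `IsLevel / IsBandTest / polyGrad /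
IsPolyStationary` is that of `Theorems/QuarticGate/Negative/LevelCeiling.lean`; the tree lemmas are
stated over the definitionally equal clauses of `Theorems/CubicParityLoud/Negative/Clauses.lean`
(same bodies), so they apply verbatim by definitional unfolding.
-/

noncomputable section

-- Summit.<Summit>.<Problem> duplicate namespace is the tree's mandated layout for single-conjunct summits.
set_option linter.dupNamespace false

namespace Summit.AnomalousDissipation.AnomalousDissipation.Theorems.MomentParityUniformResolution

open MeasureTheory Filter Topology
open scoped ENNReal
open Literature.Analysis.FunctionSpaces Literature.Analysis.FluidPDE
open Summit.AnomalousDissipation.AnomalousDissipation.Theses.MomentParity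
open Summit.AnomalousDissipation.AnomalousDissipation.Theorems.QuarticGate.Negative

/-- **S2 `stub_cylOfPoly`.** A probability law carried by level-`N` fields in a ball which is polynomially
stationary at every order annihilates the generator row of every compactly supported `C¹` cylindrical test
functional with level-`N` band fields (Galerkin invariance in FMRT's sense), and that row is integrable:
continuity of the row on the compact level ball, and Weierstrass approximation with first derivatives on
the compact coordinate image (`MomentParityMomentClosure.integral_nsGeneratorPairing_grad_eq_zero`). -/
theorem stub_cylOfPoly (f : UnitAddTorus (Fin 3) → EuclideanSpace ℝ (Fin 3)) (hf : Torus.IsSmooth f)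
    (ν : ℝ) (N : ℕ) (R : ℝ) (μ : Measure (Torus.energySpace (Fin 3))) [IsProbabilityMeasure μ]
    (hlev : ∀ᵐ u ∂μ, IsLevel N u) (hR : ∀ᵐ u ∂μ, ‖u‖ ≤ R) (hst : ∀ d : ℕ, IsPolyStationary ν f N d μ) :
    ∀ Φ : Torus.CylindricalTest (Fin 3), (∀ i, IsBandTest N (Φ.g i)) →
      Integrable (fun u => Torus.nsGeneratorPairing ν f u (Φ.grad u)) μ ∧
        ∫ u, Torus.nsGeneratorPairing ν f u (Φ.grad u) ∂μ = 0 := by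
  intro Φ hband
  -- the support radius is nonnegative (`μ` is a probability measure)
  have hR0 : 0 ≤ R := by
    obtain ⟨u, hu⟩ := hR.exists
    exact (norm_nonneg u).trans hu
  -- the compact carrier, in the vocabulary of the moment-closure lemmas
  have hμK : ∀ᵐ u ∂μ, u ∈ {u : Torus.energySpace (Fin 3) |
      Summit.AnomalousDissipation.AnomalousDissipation.Theorems.CubicParityLoud.Negative.IsLevel N u ∧
        ‖u‖ ≤ R} :=
    hlev.and hR
  have hK := MomentParityMomentClosure.isCompact_levelBall N hR0
  refine ⟨MomentParityMomentClosure.integrable_of_continuous_of_ae_mem hK hμK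
      (Torus.continuous_nsGeneratorPairing_grad ν hf.integrable Φ),
    MomentParityMomentClosure.integral_nsGeneratorPairing_grad_eq_zero ν hf.integrable hR0 hμK Φ
      fun P => ?_⟩
  -- the polynomial row of order `deg P + 1`
  exact (hst (P.totalDegree + 1) Φ.m Φ.g P hband le_rfl).2

end Summit.AnomalousDissipation.AnomalousDissipation.Theorems.MomentParityUniformResolution

end
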